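import Summits.Ventures.PercRepro.StarGadgetGraphDefs

/-!
# The star gadget — hub profiles (graph half, module 3a: finite vocabulary)

Everything the graph half needs to know about a hub is a function of its TYPE `T : HubType` and its
STATE `s : HubEdge T → Bool` (which of its edges are open), once the MODE of the configuration is
fixed — the mark the centre `x` attaches to (`some m`), or none (`Mode := Option (Fin 3)`).  This
module defines that finite vocabulary, with no graph in sight:

* `xo s` / `mo s m` / `hasM T m` — the `x`-edge is open / the `m`-edge is open / the type has `m`;
* `inA μ T s` — the hub states ALLOWED in mode `μ` (at most one open mark edge; a hub with open
  `x`-edge carries no mark but the mode's);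
* `inCl μ m T s` — the hub lies in the open cluster of the mark `m`;
* `Hf μ i T s` — the H-adjacency (`HAdj` of `C026HGraph`, with `c` the centre of `M`) of the central
  `i` (`a b c x = 0 1 2 3`) to the hub, as a formula;
* the finite fact sets `Dset μ X i j T` (the hub is outside the avoided cluster `X` and H-adjacent to
  both `i` and `j`) and `Wset μ T` (the hub witnesses the mode);
* `T2 cx β μ i j` (H-adjacency between centrals) and `nx X μ i` (the central `i` avoids `X`).

The next module proves that these formulas are what `HAdj` / `cluster` are on the gadget.
-/

namespace PercRepro.StarGadgetGraph

/-- The `x`-edge of a hub state is open. -/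
def xo {T : HubType} (s : HubEdge T → Bool) : Prop := s none = true

/-- The edge to the mark `m` exists and is open in the hub state `s`. -/
def mo {T : HubType} (s : HubEdge T → Bool) (m : Fin 3) : Prop :=
  ∃ i, T.marks.get i = m ∧ s (some i) = true

/-- The hub type `T` has the mark `m`. -/
def hasM (T : HubType) (m : Fin 3) : Prop := m ∈ T.marks

/-- `xo` is decidable. -/
instance {T : HubType} (s : HubEdge T → Bool) : Decidable (xo s) := by unfold xo; infer_instance

/-- `mo` is decidable. -/
instance {T : HubType} (s : HubEdge T → Bool) (m : Fin 3) : Decidable (mo s m) := by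
  unfold mo; infer_instance

/-- `hasM` is decidable. -/
instance (T : HubType) (m : Fin 3) : Decidable (hasM T m) := by unfold hasM; infer_instance

/-- The mode of a configuration: the mark the centre attaches to, or `none` (mode R). -/
abbrev Mode := Option (Fin 3)

/-- The hub states allowed in mode `μ`: at most one open mark edge, and a hub with open `x`-edge
carries no open mark edge except to the mode's mark. -/
def inA (μ : Mode) (T : HubType) (s : HubEdge T → Bool) : Prop :=
  (∀ m m', mo s m → mo s m' → m = m') ∧ (xo s → ∀ m, mo s m → μ = some m)

/-- The hub lies in the open cluster of the mark `m` (in mode `μ`): through its own open `m`-edge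
with closed `x`-edge, or through the centre when `x` attaches to `m`. -/
def inCl (μ : Mode) (m : Fin 3) (T : HubType) (s : HubEdge T → Bool) : Prop :=
  (¬ xo s ∧ mo s m) ∨ (μ = some m ∧ xo s)

/-- H-adjacency of a mark `m ≠ c` to the hub: through the edge `m – h` when the hub lies in `M`, or
by free movement when both lie outside `M` in the cluster of `m`. -/
def HfMark (μ : Mode) (m : Fin 3) (T : HubType) (s : HubEdge T → Bool) : Prop :=
  (inCl μ 2 T s ∧ hasM T m) ∨ (¬ inCl μ 2 T s ∧ inCl μ m T s)

/-- H-adjacency of the centre mark `c` to the hub: the edge `c – h` exists, and is closed if the hub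
lies in `M`. -/
def HfC (μ : Mode) (T : HubType) (s : HubEdge T → Bool) : Prop :=
  hasM T 2 ∧ (inCl μ 2 T s → ¬ mo s 2)

/-- H-adjacency of the centre `x` to the hub: in mode M (`x ∈ M`) iff the `x`-edge is closed;
otherwise iff the hub lies in `M`, or in the cluster of `x`. -/
def HfX (μ : Mode) (T : HubType) (s : HubEdge T → Bool) : Prop :=
  if μ = some 2 then ¬ xo s
  else inCl μ 2 T s ∨ xo s ∨ (¬ xo s ∧ ∃ m, μ = some m ∧ mo s m)

/-- H-adjacency of the central `i` (`a b c x = 0 1 2 3`) to the hub, as a formula in the mode, the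
type and the state. -/
def Hf (μ : Mode) (i : Fin 4) (T : HubType) (s : HubEdge T → Bool) : Prop :=
  if i = 3 then HfX μ T s
  else if i = 2 then HfC μ T s
  else if i = 1 then HfMark μ 1 T s
  else HfMark μ 0 T s

/-- `inA` is decidable. -/
instance (μ : Mode) (T : HubType) (s : HubEdge T → Bool) : Decidable (inA μ T s) := by
  unfold inA; infer_instance

/-- `inCl` is decidable. -/
instance (μ : Mode) (m : Fin 3) (T : HubType) (s : HubEdge T → Bool) : Decidable (inCl μ m T s) := by
  unfold inCl; infer_instance

/-- `HfMark` is decidable. -/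
instance (μ : Mode) (m : Fin 3) (T : HubType) (s : HubEdge T → Bool) :
    Decidable (HfMark μ m T s) := by
  unfold HfMark; infer_instance

/-- `HfC` is decidable. -/
instance (μ : Mode) (T : HubType) (s : HubEdge T → Bool) : Decidable (HfC μ T s) := by
  unfold HfC; infer_instance

/-- `HfX` is decidable. -/
instance (μ : Mode) (T : HubType) (s : HubEdge T → Bool) : Decidable (HfX μ T s) := by
  unfold HfX; infer_instance

/-- `Hf` is decidable. -/
instance (μ : Mode) (i : Fin 4) (T : HubType) (s : HubEdge T → Bool) : Decidable (Hf μ i T s) := by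
  unfold Hf; infer_instance

/-- The hub lies in the avoided set `X` (`none` = nothing avoided, `some m` = the cluster of `m`). -/
def inX (μ : Mode) (X : Option (Fin 3)) (T : HubType) (s : HubEdge T → Bool) : Prop :=
  ∃ m, X = some m ∧ inCl μ m T s

/-- `inX` is decidable. -/
instance (μ : Mode) (X : Option (Fin 3)) (T : HubType) (s : HubEdge T → Bool) :
    Decidable (inX μ X T s) := by
  unfold inX; infer_instance

/-- The allowed states of the type `T` in mode `μ`. -/
def Aset (μ : Mode) (T : HubType) : Finset (HubEdge T → Bool) :=
  Finset.univ.filter fun s => inA μ T s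

/-- The states of the type `T` (allowed in mode `μ`) outside `X` and H-adjacent to both centrals
`i` and `j`: the detour states of the pair `(i, j)`. -/
def Dset (μ : Mode) (X : Option (Fin 3)) (i j : Fin 4) (T : HubType) :
    Finset (HubEdge T → Bool) :=
  Finset.univ.filter fun s => inA μ T s ∧ ¬ inX μ X T s ∧ Hf μ i T s ∧ Hf μ j T s

/-- The states of the type `T` (allowed in mode `μ`) witnessing the mode: open `x`-edge and open
edge to the mode's mark. -/
def Wset (μ : Mode) (T : HubType) : Finset (HubEdge T → Bool) :=
  Finset.univ.filter fun s => inA μ T s ∧ xo s ∧ ∃ m, μ = some m ∧ mo s m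

/-- H-adjacency between two distinct centrals (`a b c x = 0 1 2 3`) on the gadget with the edge
`c – x` iff `cx`, that edge open iff `β`, in mode `μ`: `a – x` in mode K, `b – x` in mode L, and
`c – x` through the edge when it exists and is not an open edge inside `M`. -/
def T2 (cx β : Bool) (μ : Mode) (i j : Fin 4) : Bool :=
  ((i = 0 ∧ j = 3) ∨ (i = 3 ∧ j = 0)) ∧ μ = some 0 ∨
  ((i = 1 ∧ j = 3) ∨ (i = 3 ∧ j = 1)) ∧ μ = some 1 ∨
  ((i = 2 ∧ j = 3) ∨ (i = 3 ∧ j = 2)) ∧ cx = true ∧ ¬ (μ = some 2 ∧ β = true)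

/-- The central `i` avoids `X`: `X = none` avoids nothing; `X = some m` avoids the cluster of `m`,
which contains the mark `m` and, in mode `some m`, the centre. -/
def nx (X : Option (Fin 3)) (μ : Mode) (i : Fin 4) : Bool :=
  ∀ m, X = some m → ¬ (i = m.castSucc ∨ (i = 3 ∧ μ = some m))

/-- The adjacency matrix of the contracted H-graph on the centrals: both avoid `X`, and either a
direct H-step (`T2`) or a detour through a hub (`d`). -/
def cellMat (cx β : Bool) (μ : Mode) (X : Option (Fin 3)) (d : Fin 4 → Fin 4 → Bool)
    (i j : Fin 4) : Bool :=
  nx X μ i && nx X μ j && (T2 cx β μ i j || d i j)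

/-! ### Sanity values (the bases of the 29 terms of `F`: allowed states per mode and type) -/

/-- Mode M: 4, 5, 5, 6 allowed states for the types `ab, ac, bc, abc`. -/
example : (Aset (some 2) .ab).card = 4 ∧ (Aset (some 2) .ac).card = 5 ∧
    (Aset (some 2) .bc).card = 5 ∧ (Aset (some 2) .abc).card = 6 := by decide +kernel

/-- Mode K: 5, 5, 4, 6. -/
example : (Aset (some 0) .ab).card = 5 ∧ (Aset (some 0) .ac).card = 5 ∧
    (Aset (some 0) .bc).card = 4 ∧ (Aset (some 0) .abc).card = 6 := by decide +kernel

/-- Mode R: 4, 4, 4, 5. -/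
example : (Aset none .ab).card = 4 ∧ (Aset none .ac).card = 4 ∧
    (Aset none .bc).card = 4 ∧ (Aset none .abc).card = 5 := by decide +kernel

end PercRepro.StarGadgetGraph
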